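import Literature.Analysis.OperatorTheory.YangMillsMatrixModelDiscreteness
import HarnessLib

/-!
# Lüscher's matrix model: the operational min–max toolkit (lower-bound principle, near-optimal
# trial spaces, growth of the excitation energies)

Topic `Literature/Analysis/OperatorTheory` — fourth companion of
`YangMillsMatrixModelDiscreteSpectrum.lean` (after `…ValleyBound`, `…Levels`, `…Discreteness`),
theorems only, in the tree's vocabulary (`physLevel k = inf levelSet k`, `energyForm`, `l2sq`,
`IsTestFn`, `IsGaugeInv`).  These are the three ways the min–max levels `μ_k^inv` of
`𝔥 = −½Δ + ¼Σ|x_i × x_j|²` are USED in semiclassical arguments (Reed–Simon IV, Thm. XIII.1–XIII.2 and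
the discussion following them):

* `exists_ne_zero_forall_integral_mul_eq_zero` — in a `k`-dimensional space of trial functions there
  is a non-zero function orthogonal to any `n < k` given continuous functions (rank–nullity);
* `le_physLevel_of_forall_orthogonal` — **the lower-bound (max–min ≤ min–max) principle**: if every
  admissible `ψ` orthogonal to `g_1, …, g_n` (`n < k`) has `E‖ψ‖² ≤ 𝔮(ψ)`, then `E ≤ μ_k^inv`;
* `exists_subspace_rayleigh_lt` — **near-optimal trial spaces**: for every `k` and `ε > 0` there is an
  admissible `k`-dimensional `W` with Rayleigh quotient `≤ μ_k^inv + ε` on all of `W` (the supply of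
  quasimodes);
* `tendsto_minmaxLevel_testFn_atTop` — the same divergence for the min–max levels over ALL `C²_c` trial
  functions (Simon 1983 Cor. 4 as printed, `su(2)`, `ν = 3`), and `minmaxLevel_testFn_le_physLevel`;
* `tendsto_physLevel_succ_sub_atTop`, `physLevel_succ_sub_nonneg`, `physLevel_succ_sub_mono` — the
  excitation energies `Δ_k = μ_{k+1}^inv − μ_1^inv` are `≥ 0`, non-decreasing and tend to `∞`
  (from `tendsto_physLevel_atTop`, Simon 1983 Cor. 4); the route file
  `Summits/…/Theorems/FemtoTransferGapLevels.lean` calls this quantity `levelGap k`.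

## References
* [ReedSimonIV1978] M. Reed, B. Simon, *Methods of Modern Mathematical Physics IV*, Thm. XIII.1,
  XIII.2 (min–max principle, both forms).
* [SimonB1983DiscreteSpectrum] B. Simon, Ann. Phys. 146 (1983) 209–220, Cor. 4.
* [Luscher1983] M. Lüscher, Nucl. Phys. B219 (1983) 233–261, §1.
-/

noncomputable section

open Matrix MeasureTheory Filter Topology
open scoped BigOperators

namespace Literature.Analysis.OperatorTheory.YMMatrixModel

/-- `ψ g` is integrable for a test function `ψ` and a continuous `g`. [cite: ReedSimonIV1978, Thm. XIII.2] -/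
theorem IsTestFn.integrable_mul {ψ : ZM → ℝ} (hψ : IsTestFn ψ) {g : ZM → ℝ} (hg : Continuous g) :
    Integrable fun x => ψ x * g x :=
  (hψ.continuous.mul hg).integrable_of_hasCompactSupport hψ.2.mul_right

/-- **Rank–nullity supply of orthogonal trial functions**: a `k`-dimensional space `W` of test
functions contains a non-zero function `L²`-orthogonal to any `n < k` continuous functions
`g_1, …, g_n`. [cite: ReedSimonIV1978, Thm. XIII.2] -/
theorem exists_ne_zero_forall_integral_mul_eq_zero {k n : ℕ} (hn : n < k)
    (W : Submodule ℝ (ZM → ℝ)) (hW : Module.finrank ℝ W = k) (hadm : ∀ ψ ∈ W, IsTestFn ψ)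
    (g : Fin n → ZM → ℝ) (hg : ∀ i, Continuous (g i)) :
    ∃ ψ ∈ W, ψ ≠ 0 ∧ ∀ i, ∫ x, ψ x * g i x = 0 := by
  obtain ⟨m, rfl⟩ : ∃ m, k = m + 1 := ⟨k - 1, by omega⟩
  haveI : Module.Finite ℝ W := Module.finite_of_finrank_eq_succ hW
  -- the (linear, on `W`) map of moments against the `g_i`
  let Φ : W →ₗ[ℝ] (Fin n → ℝ) :=
    { toFun := fun ψ i => ∫ x, (ψ : ZM → ℝ) x * g i x
      map_add' := fun ψ ψ' => by
        funext i
        simp only [Submodule.coe_add, Pi.add_apply, add_mul]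
        exact integral_add ((hadm _ ψ.2).integrable_mul (hg i)) ((hadm _ ψ'.2).integrable_mul (hg i))
      map_smul' := fun c ψ => by
        funext i
        simp only [Submodule.coe_smul, Pi.smul_apply, smul_eq_mul, RingHom.id_apply, mul_assoc]
        exact integral_const_mul _ _ }
  have hrank : Module.finrank ℝ (LinearMap.range Φ) ≤ n :=
    (Submodule.finrank_le _).trans (by simp)
  have hker : 0 < Module.finrank ℝ (LinearMap.ker Φ) := by
    have h := LinearMap.finrank_range_add_finrank_ker Φ
    rw [hW] at h
    omega
  obtain ⟨⟨ψ, hψker⟩, hne⟩ := (Module.finrank_pos_iff_exists_ne_zero (R := ℝ) (M := LinearMap.ker Φ)).1 hker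
  refine ⟨(ψ : ZM → ℝ), ψ.2, fun h0 => hne ?_, fun i => ?_⟩
  · have hψ0 : ψ = 0 := Subtype.ext h0
    exact Subtype.ext hψ0
  · have h := LinearMap.mem_ker.1 hψker
    exact congr_fun h i

/-- **The lower-bound principle** («max–min ≤ min–max», the operational form of Reed–Simon
Thm. XIII.1/XIII.2): if `n < k` continuous functions `g_1, …, g_n` are such that every admissible
trial function orthogonal to all of them satisfies `E ‖ψ‖² ≤ 𝔮(ψ)`, then `E ≤ μ_k^inv`.  (Typical use,
Simon 1983 / IMS localisation: `g_i` = cut-off approximate eigenfunctions of the wells.)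
[cite: ReedSimonIV1978, Thm. XIII.2] -/
theorem le_physLevel_of_forall_orthogonal {k n : ℕ} (hn : n < k) (g : Fin n → ZM → ℝ)
    (hg : ∀ i, Continuous (g i)) {E : ℝ}
    (hE : ∀ ψ : ZM → ℝ, IsTestFn ψ → IsGaugeInv ψ → (∀ i, ∫ x, ψ x * g i x = 0) →
      E * l2sq ψ ≤ energyForm ψ) :
    E ≤ physLevel k := by
  rw [physLevel_eq_sInf]
  refine le_csInf (levelSet_nonempty k) fun s hs => ?_
  obtain ⟨W, hWk, hadm, hray⟩ := hs
  obtain ⟨ψ, hψW, hne, horth⟩ := exists_ne_zero_forall_integral_mul_eq_zero hn W hWk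
    (fun ψ hψ => (hadm ψ hψ).1) g hg
  have h1 := hE ψ (hadm ψ hψW).1 (hadm ψ hψW).2 horth
  have h2 := hray ψ hψW
  have hpos := l2sq_pos_of_ne_zero (hadm ψ hψW).1 hne
  exact le_of_mul_le_mul_right (h1.trans h2) hpos

/-- The lower-bound principle with no orthogonality condition (`n = 0`): a uniform bound
`E‖ψ‖² ≤ 𝔮(ψ)` on admissible trial functions bounds every level, `E ≤ μ_k^inv` (`k ≥ 1`).
[cite: ReedSimonIV1978, Thm. XIII.1] -/
theorem le_physLevel_of_forall {k : ℕ} (hk : 1 ≤ k) {E : ℝ}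
    (hE : ∀ ψ : ZM → ℝ, IsTestFn ψ → IsGaugeInv ψ → E * l2sq ψ ≤ energyForm ψ) :
    E ≤ physLevel k :=
  le_physLevel_of_forall_orthogonal (n := 0) hk (fun i => Fin.elim0 i) (fun i => Fin.elim0 i)
    fun ψ hψ hg _ => hE ψ hψ hg

/-- **Near-optimal trial spaces** (the supply of quasimodes): for `k ≥ 1` and `ε > 0` there is an
admissible `k`-dimensional space on which the Rayleigh quotient is `≤ μ_k^inv + ε` (any `k`; for
`k = 0` both sides are trivial).
[cite: ReedSimonIV1978, Thm. XIII.1] -/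
theorem exists_subspace_rayleigh_lt (k : ℕ) {ε : ℝ} (hε : 0 < ε) :
    ∃ W : Submodule ℝ (ZM → ℝ), Module.finrank ℝ W = k ∧ (∀ ψ ∈ W, IsTestFn ψ ∧ IsGaugeInv ψ) ∧
      ∀ ψ ∈ W, energyForm ψ ≤ (physLevel k + ε) * l2sq ψ := by
  have hlt : sInf (levelSet k) < physLevel k + ε := by
    rw [← physLevel_eq_sInf]
    linarith
  obtain ⟨s, hs, hsε⟩ := exists_lt_of_csInf_lt (levelSet_nonempty k) hlt
  obtain ⟨W, hWk, hadm, hray⟩ := hs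
  exact ⟨W, hWk, hadm, fun ψ hψ =>
    (hray ψ hψ).trans (mul_le_mul_of_nonneg_right hsε.le (l2sq_nonneg ψ))⟩

/-- A trial function in a space of Rayleigh quotient `≤ μ_k^inv + ε` that is, moreover, non-zero has
`𝔮(ψ)/‖ψ‖² ≤ μ_k^inv + ε`. [cite: ReedSimonIV1978, Thm. XIII.1] -/
theorem rayleigh_le_of_mem {W : Submodule ℝ (ZM → ℝ)} {c : ℝ}
    (hadm : ∀ ψ ∈ W, IsTestFn ψ ∧ IsGaugeInv ψ) (hray : ∀ ψ ∈ W, energyForm ψ ≤ c * l2sq ψ)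
    {ψ : ZM → ℝ} (hψ : ψ ∈ W) (hne : ψ ≠ 0) : energyForm ψ / l2sq ψ ≤ c := by
  have hpos := l2sq_pos_of_ne_zero (hadm ψ hψ).1 hne
  rw [div_le_iff₀ hpos]
  exact hray ψ hψ

/-! ### The excitation energies `Δ_k = μ_{k+1}^inv − μ_1^inv` -/

/-- `Δ_k ≥ 0`. [cite: ReedSimonIV1978, Thm. XIII.1] -/
theorem physLevel_succ_sub_nonneg (k : ℕ) : 0 ≤ physLevel (k + 1) - physLevel 1 := by
  have h := physLevel_mono (k := 1) (l := k + 1) le_rfl (by omega)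
  linarith

/-- `Δ_k` is non-decreasing in `k`. [cite: ReedSimonIV1978, Thm. XIII.1] -/
theorem physLevel_succ_sub_mono : Monotone fun k : ℕ => physLevel (k + 1) - physLevel 1 := by
  intro k l hkl
  have h := physLevel_mono (k := k + 1) (l := l + 1) (by omega) (by omega)
  simp only [sub_le_sub_iff_right]
  exact h

/-- `Δ_0 = 0` and `Δ_1 = ε₁` (`luscherEps1`). [cite: Luscher1983, §1] -/
theorem physLevel_succ_sub_one : physLevel (1 + 1) - physLevel 1 = luscherEps1 := rfl

/-- **`Δ_k → ∞`**: the excitation energies of the invariant sector are unbounded (discreteness,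
Simon 1983 Cor. 4, via `tendsto_physLevel_atTop`). [cite: SimonB1983DiscreteSpectrum, Cor. 4] -/
theorem tendsto_physLevel_succ_sub_atTop :
    Tendsto (fun k : ℕ => physLevel (k + 1) - physLevel 1) atTop atTop := by
  have h1 : Tendsto (fun k : ℕ => physLevel (k + 1)) atTop atTop :=
    tendsto_physLevel_atTop.comp (tendsto_add_atTop_nat 1)
  exact tendsto_atTop_add_const_right atTop (-physLevel 1) h1

/-- For every `E` the levels eventually exceed `μ_1^inv + E`: `∃ K, ∀ k ≥ K, E ≤ Δ_k`.
[cite: SimonB1983DiscreteSpectrum, Cor. 4] -/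
theorem exists_forall_le_physLevel_succ_sub (E : ℝ) :
    ∃ K : ℕ, ∀ k, K ≤ k → E ≤ physLevel (k + 1) - physLevel 1 :=
  (tendsto_atTop_atTop.1 tendsto_physLevel_succ_sub_atTop) E

/-! ### The full (not necessarily colour-invariant) sector: Simon's Corollary 4 as printed

`finrank_le_dimBound` never used colour-rotation invariance, so the same dimension count bounds the
min–max levels `minmaxLevel IsTestFn k` of `𝔥` on ALL `C²_c` trial functions — a form core of
`H₃ = −½Δ + ¼Σ(x_α × x_β)²` on `L²(ℝ⁹)` — and these, too, tend to infinity: B. Simon, Ann. Phys. 146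
(1983), Cor. 4 («`H₃` has discrete spectrum»), `𝔞 = su(2)`, `ν = 3`, in min–max form. -/

/-- The Rayleigh set of order `k` over all test functions is non-empty (the invariant shells are test
functions). [cite: ReedSimonIV1978, Thm. XIII.1] -/
theorem testFnLevelSet_nonempty (k : ℕ) :
    {s : ℝ | ∃ W : Submodule ℝ (ZM → ℝ), Module.finrank ℝ W = k ∧ (∀ ψ ∈ W, IsTestFn ψ) ∧
      ∀ ψ ∈ W, energyForm ψ ≤ s * l2sq ψ}.Nonempty := by
  obtain ⟨W, hW, hadm, hray⟩ := shellBound_mem_levelSet k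
  exact ⟨shellBound k, W, hW, fun ψ hψ => (hadm ψ hψ).1, hray⟩

/-- Every element of the test-function Rayleigh set of order `k ≥ 1` is `≥ 0`.
[cite: ReedSimonIV1978, Thm. XIII.1] -/
theorem nonneg_of_mem_testFnLevelSet {k : ℕ} (hk : 1 ≤ k) {s : ℝ}
    (hs : s ∈ {s : ℝ | ∃ W : Submodule ℝ (ZM → ℝ), Module.finrank ℝ W = k ∧ (∀ ψ ∈ W, IsTestFn ψ) ∧
      ∀ ψ ∈ W, energyForm ψ ≤ s * l2sq ψ}) : 0 ≤ s := by
  obtain ⟨W, hW, hadm, hray⟩ := hs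
  obtain ⟨n, rfl⟩ : ∃ n, k = n + 1 := ⟨k - 1, by omega⟩
  haveI : Module.Finite ℝ W := Module.finite_of_finrank_eq_succ hW
  let b := Module.finBasisOfFinrankEq ℝ W hW
  have hb : (b 0 : ZM → ℝ) ≠ 0 := fun h => b.ne_zero 0 (Subtype.ext h)
  have hmem : (b 0 : ZM → ℝ) ∈ W := (b 0).2
  have hpos := l2sq_pos_of_ne_zero (hadm _ hmem) hb
  have h := hray _ hmem
  nlinarith [energyForm_nonneg (b 0 : ZM → ℝ)]

/-- **The invariant levels dominate the full ones**: `μ_k(𝔥 on C²_c) ≤ μ_k^inv` (`k ≥ 1`; an infimum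
over a larger class of trial spaces). [cite: ReedSimonIV1978, Thm. XIII.1] -/
theorem minmaxLevel_testFn_le_physLevel {k : ℕ} (hk : 1 ≤ k) :
    minmaxLevel IsTestFn k ≤ physLevel k := by
  rw [physLevel_eq_sInf]
  refine le_csInf (levelSet_nonempty k) fun s hs => ?_
  obtain ⟨W, hW, hadm, hray⟩ := hs
  exact csInf_le ⟨0, fun t ht => nonneg_of_mem_testFnLevelSet hk ht⟩
    ⟨W, hW, fun ψ hψ => (hadm ψ hψ).1, hray⟩

/-- **Energy below `E` forces dimension `≤ N(E)` in the full sector**: for `k > N(E)` the `k`-th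
min–max level of `𝔥` over all `C²_c` trial functions is `≥ E`. [cite: SimonB1983DiscreteSpectrum, Cor. 4] -/
theorem le_minmaxLevel_testFn_of_dimBound_lt {E : ℝ} (hE : 0 ≤ E) {k : ℕ} (hk : dimBound E < k) :
    E ≤ minmaxLevel IsTestFn k := by
  rcases Nat.eq_zero_or_pos k with rfl | hpos
  · exact absurd hk (not_lt.2 (by simpa using dimBound_nonneg E))
  refine le_csInf (testFnLevelSet_nonempty k) fun s hs => ?_
  by_contra hlt
  rw [not_le] at hlt
  obtain ⟨W, hWk, hadm, hray⟩ := hs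
  obtain ⟨n, hn⟩ : ∃ n, k = n + 1 := ⟨k - 1, by omega⟩
  haveI : FiniteDimensional ℝ W := Module.finite_of_finrank_eq_succ (hWk.trans hn)
  have hray' : ∀ ψ ∈ W, energyForm ψ ≤ E * l2sq ψ := fun ψ hψ =>
    (hray ψ hψ).trans (mul_le_mul_of_nonneg_right hlt.le (l2sq_nonneg ψ))
  have h := finrank_le_dimBound hE W hadm hray'
  rw [hWk] at h
  linarith

/-- **Simon 1983, Corollary 4, for `𝔞 = su(2)`, `ν = 3`, in min–max form**: the min–max levels of
`𝔥 = −½Δ + ¼Σ|x_i × x_j|²` over all `C²_c(ℝ⁹)` trial functions tend to `+∞` — `𝔥` has purely discrete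
spectrum although the classically allowed region `{V ≤ E}` has infinite volume.
[cite: SimonB1983DiscreteSpectrum, Cor. 4] -/
theorem tendsto_minmaxLevel_testFn_atTop : Tendsto (minmaxLevel IsTestFn) atTop atTop := by
  refine tendsto_atTop_atTop.2 fun E => ⟨⌈dimBound (max E 0)⌉₊ + 1, fun k hk => ?_⟩
  refine (le_max_left E 0).trans (le_minmaxLevel_testFn_of_dimBound_lt (le_max_right E 0) ?_)
  have h1 : dimBound (max E 0) ≤ (⌈dimBound (max E 0)⌉₊ : ℝ) := Nat.le_ceil _
  have h2 : ((⌈dimBound (max E 0)⌉₊ + 1 : ℕ) : ℝ) ≤ k := by exact_mod_cast hk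
  push_cast at h2
  linarith

end Literature.Analysis.OperatorTheory.YMMatrixModel

end
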